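import Literature.NumberTheory.Automorphic.FixedCosetsStableLattices   -- ★ `Λ(g) = span 𝒪 (range ↑gᵀ)`: `span_range_transpose_mul`, `span_range_transpose_eq_one_iff_mem_glInt`, `mem_span_range_transpose_one_iff`
import Literature.NumberTheory.Automorphic.HeckeTransversalGL          -- ★ `IsIntegralMatrix`, `mem_glInt_of_isIntegralMatrix`, `valuation_det_eq_one_of_mem_glInt`, `isIntegralMatrix_of_mem_glInt`
import Literature.NumberTheory.Automorphic.IntegralMatrixReduction     -- ★ `red`, `redMat`, `redMat_mul`, `red_det`, `valuation_eq_one_of_red_ne_zero`, `red_ne_zero_of_valuation_eq_one`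
import Literature.LinearAlgebra.Matrix.AdjugateOfNilpotent             -- ★ `minpoly_eq_charpoly_of_isNilpotent_of_rank`, `rank_jordanBlock_zero` (+ ★ `CyclicVectorCompanionMatrix`, ★ `JordanBlock`, ★ `CompanionMatrix`)
import HarnessLib

/-!
# Residually unipotent fixed cosets of Jordan rank `n − 1` are the lattices FREE OF RANK ONE over `𝒪[γ]`:
# `rank (red(g⁻¹γg) − 1) = n − 1 ↔ Λ(g) = ⊕_{i<n} 𝒪·γ^i v` (cyclic vector ⟺ nonderogatory, lifted through the residue field)

Topic `NumberTheory/Automorphic`; namespace `Literature.NumberTheory.Automorphic`.  THEOREMS ONLY (no definition, no instance, no notation, no named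
fact, no `sorry`); generic: any field `F` with a valuative relation (`𝒪 = 𝒪[F]`, `𝓀 = 𝓀[F]`), any `n`; zero `U(3)`-specific content.  Cell
`pub/hodgecm-mathlib` (D-0151), crux H413 = `stmt-HodgeConjecture-24833`; road «S3-tree» (LEAD F0P3a-plan (g11) WORD T10-2, architect A-p16 (g29) A-57∕A-58),
brick **T3′ «depth-zero κ-transfer»** (holder F0P3b-p01 (g11), route 16:06:37Z: «the ONE new count is the regular-unipotent stratum `n₂`; `rank(γ̄_L − 1) = 2`
⟺ `L̄` cyclic over `𝔽[γ̄]` ⟺ `L` is a FREE `R₀ = 𝒪_w[γ]`-module of rank 1»), organ **(F1)** (second A-p12 (g21)).  HONEST LABEL: HC_CM is proved only modulo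
the 2 remaining named inputs (hLiu418 24832, h413 24833) until rung 0 closes; nothing printed is asserted here — this is linear algebra over a field and a
valuation ring; S3 stays a print row until the road's END lands.

THE MATHEMATICS.  (§1, over a field `𝕜`) For `M ∈ M_n(𝕜)`: a vector `v` with `v, Mv, …, M^{n−1}v` linearly independent (a CYCLIC VECTOR) exists iff
`deg q_M = n` (`q_M` the minimal polynomial; Hungerford Thm VII.4.3 ∕ Horn–Johnson Thm 3.3.15 (a), over the tree's ★ `exists_forall_aeval_apply_eq_zero_imp` ∕
★ `linearIndependent_pow_apply_of_forall_aeval`); for NILPOTENT `N` this is `rank N = n − 1` (one Jordan block; Horn–Johnson 3.2.P27 (b), ★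
`minpoly_eq_charpoly_of_isNilpotent_of_rank` and ★ `exists_conj_eq_of_minpoly_eq_charpoly` with `J_n(0)`, ★ `rank_jordanBlock_zero`); and `q_{M−1}(X) = q_M(X+1)`
has the same degree (Mathlib `minpoly.sub_algebraMap`), so for UNIPOTENT `M`: **`rank (M − 1) = n − 1 ↔ ∃ v, {M^i v}_{i<n}` linearly independent**.
(§2, over `𝒪`) For an INTEGRAL `k ∈ M_n(F)`: the reduction of the Krylov matrix `P = [v | kv | ⋯ | k^{n−1}v]` of an integral `v` is the Krylov matrix of
`(k̄, v̄)`; `P ∈ GL_n(𝒪)` iff `det P̄ ≠ 0` (★ `mem_glInt_of_isIntegralMatrix`, ★ `red_det`), i.e. **`k̄` has a cyclic vector iff `𝒪ⁿ = ⊕_{i<n} 𝒪·k^i v` for some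
`v`** (every `v̄` lifts, Mathlib `IsLocalRing.residue_surjective`; conversely `span 𝒪 {k^i v} = 𝒪ⁿ` forces `P` invertible with `Λ(P) = Λ(1)`, ★
`span_range_transpose_eq_one_iff_mem_glInt`) — «`𝒪ⁿ` is free of rank one over `𝒪[k]` on the generator `v`» written in coordinates (Cayley–Hamilton truncates
at `n`; the order `𝒪[k]` is never named).  This is Nakayama's lemma for the cyclic module `𝒪[k]·v`, proved here by the determinant.
(§3) TRANSPORT to a fixed coset: for `γ, g ∈ GL_n(F)` with `k = g⁻¹γg ∈ GL_n(𝒪)` (★ `FixedCosetsStableLattices`: `γ·Λ(g) = Λ(g)`), `g` carries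
`⊕ 𝒪·k^i v = 𝒪ⁿ` to `⊕ 𝒪·γ^i (gv) = Λ(g)`; hence THE HEAD **`rank (redMat ↑(g⁻¹γg) − 1) = n − 1 ↔ ∃ w, Λ(g) = span 𝒪 {γ^i w}_{i<n}`** for residually
unipotent `g⁻¹γg` — at `n = 3`: the `γ`-fixed vertex `Λ(g)` has `rank(γ̄ − 1) = 2` (regular unipotent reduction) iff it is free of rank one over `𝒪[γ]`.

* §1 `natDegree_minpoly_matrix_le`, **`exists_linearIndependent_pow_mulVec_iff_natDegree_minpoly_eq`**, `rank_eq_sub_one_iff_natDegree_minpoly_eq_of_isNilpotent`,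
  `natDegree_minpoly_sub_one`, **`rank_sub_one_eq_iff_exists_linearIndependent_pow_mulVec`** (unipotent `M`).
* §2 `redMat_pow`, `red_mulVec_apply`, `redMat_krylov`, `isIntegralMatrix_krylov`, `transpose_krylov_apply`,
  **`exists_linearIndependent_pow_redMat_mulVec_iff_exists_span_eq_one`**.
* §3 `mulVec_pow_conj_eq`, `span_range_pow_mulVec_eq_map`, **`exists_span_eq_span_range_pow_mulVec_iff`** (transport),
  **`rank_redMat_sub_one_eq_iff_exists_span_eq_span_range_pow_mulVec`** (THE HEAD).

## References
* [HornJohnson2013] R. A. Horn, C. R. Johnson, *Matrix Analysis*, 2nd ed. (CUP 2013): Thm 3.3.15 p. 257 (nonderogatory ⟺ cyclic), §3.2 Problem 3.2.P27 (b) p. 250.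
* [Hungerford1974] T. W. Hungerford, *Algebra* (GTM 73, 1974): Thm VII.4.3 pp. 467–468 (cyclic basis `v, φv, …, φ^{r−1}v`).
* [Matsumura1987] H. Matsumura, *Commutative Ring Theory* (CUP 1987, transl. M. Reid): Thm 2.2–2.3 p. 8 (Nakayama: generators modulo `𝔪` lift).
* [Kottwitz1986] R. E. Kottwitz, *Base change for unit elements of Hecke algebras*, Compositio Math. 60 (1986): §3 (fixed cosets ↔ stable lattices).
* [Rogawski1990] J. D. Rogawski, *Automorphic Representations of Unitary Groups in Three Variables* (1990): §4.9 p. 54 (orbital integrals as lattice counts).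
-/

set_option autoImplicit false

noncomputable section

open scoped ValuativeRel Matrix MatrixGroups Polynomial
open Matrix Polynomial ValuativeRel

namespace Literature.NumberTheory.Automorphic

/-! ## §1 Over a field: cyclic vectors, the degree of the minimal polynomial, and the rank of a nilpotent -/

section Field

variable {𝕜 : Type*} [Field 𝕜] {n : ℕ}

/-- `deg q_M ≤ n` for `M ∈ M_n(𝕜)` (`q_M ∣ p_M`, `deg p_M = n`). [cite: HornJohnson2013, Thm 3.3.1 / Cor. 3.3.4 p. 192] -/
theorem natDegree_minpoly_matrix_le (M : Matrix (Fin n) (Fin n) 𝕜) : (minpoly 𝕜 M).natDegree ≤ n := by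
  have h := Polynomial.natDegree_le_of_dvd (Matrix.minpoly_dvd_charpoly M) M.charpoly_monic.ne_zero
  rwa [Matrix.charpoly_natDegree_eq_dim, Fintype.card_fin] at h

/-- **CYCLIC VECTOR ⟺ `deg q_M = n`** (Hungerford Thm VII.4.3; Horn–Johnson Thm 3.3.15 (a)): `M ∈ M_n(𝕜)` admits `v` with `v, Mv, …, M^{n−1}v` linearly
independent iff its minimal polynomial has degree `n`. [cite: Hungerford1974, Thm VII.4.3 pp. 467–468] [cite: HornJohnson2013, Thm 3.3.15 (a) p. 257] -/
theorem exists_linearIndependent_pow_mulVec_iff_natDegree_minpoly_eq (M : Matrix (Fin n) (Fin n) 𝕜) :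
    (∃ v : Fin n → 𝕜, LinearIndependent 𝕜 fun j : Fin n => M ^ (j : ℕ) *ᵥ v) ↔ (minpoly 𝕜 M).natDegree = n := by
  constructor
  · rintro ⟨v, hv⟩
    refine le_antisymm (natDegree_minpoly_matrix_le M) ?_
    by_contra hlt
    rw [not_le] at hlt
    -- `q_M = Σ_{j<n} c_j X^j` kills `v`: `Σ_j c_j • M^j v = 0`, so every `c_j = 0` and `q_M = 0`
    have hsum : ∑ j : Fin n, (minpoly 𝕜 M).coeff j • (M ^ (j : ℕ) *ᵥ v) = 0 := by
      have h0 : Polynomial.aeval M (minpoly 𝕜 M) = 0 := minpoly.aeval 𝕜 M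
      rw [Polynomial.aeval_eq_sum_range' hlt] at h0
      have h1 := congrArg (fun N : Matrix (Fin n) (Fin n) 𝕜 => N *ᵥ v) h0
      simp only [Matrix.zero_mulVec, Matrix.sum_mulVec, Matrix.smul_mulVec] at h1
      rw [← h1, ← Fin.sum_univ_eq_sum_range (fun i => (minpoly 𝕜 M).coeff i • (M ^ i *ᵥ v)) n]
    have hcoeff := Fintype.linearIndependent_iff.1 hv (fun j => (minpoly 𝕜 M).coeff j) hsum
    refine minpoly.ne_zero (Matrix.isIntegral M) (Polynomial.ext fun i => ?_)
    rw [Polynomial.coeff_zero]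
    by_cases hi : i < n
    · exact hcoeff ⟨i, hi⟩
    · exact Polynomial.coeff_eq_zero_of_natDegree_lt (lt_of_lt_of_le hlt (not_lt.1 hi))
  · intro h
    obtain ⟨v, hv⟩ := Literature.LinearAlgebra.Matrix.exists_forall_aeval_apply_eq_zero_imp (Matrix.toLin' M)
    have hd : (minpoly 𝕜 (Matrix.toLin' M)).natDegree = n := by rw [Matrix.minpoly_toLin', h]
    refine ⟨v, ?_⟩
    have hfun : (fun j : Fin n => M ^ (j : ℕ) *ᵥ v) =
        (fun k : Fin (minpoly 𝕜 (Matrix.toLin' M)).natDegree => (Matrix.toLin' M ^ (k : ℕ)) v) ∘ Fin.cast hd.symm := by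
      funext j
      rw [Function.comp_apply, Fin.val_cast, ← Matrix.toLin'_pow, Matrix.toLin'_apply]
    rw [hfun]
    exact (Literature.LinearAlgebra.Matrix.linearIndependent_pow_apply_of_forall_aeval _ v hv).comp _ (Fin.cast_injective _)

/-- **Horn–Johnson 3.2.P27 (b) in degree form**: a NILPOTENT `N ∈ M_n(𝕜)` has `rank N = n − 1` iff `deg q_N = n` (iff `N ∼ J_n(0)`).
[cite: HornJohnson2013, §3.2 Problem 3.2.P27 (b) p. 250; Thm 3.3.15] -/
theorem rank_eq_sub_one_iff_natDegree_minpoly_eq_of_isNilpotent {N : Matrix (Fin n) (Fin n) 𝕜} (hN : IsNilpotent N) :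
    N.rank = n - 1 ↔ (minpoly 𝕜 N).natDegree = n := by
  have hchar : N.charpoly = X ^ n := by
    rw [Literature.LinearAlgebra.Matrix.NilpotentSimilarToScalarMultiple.charpoly_eq_X_pow_of_isNilpotent hN, Fintype.card_fin]
  constructor
  · intro hr
    have hmin := Literature.LinearAlgebra.Matrix.AdjugateOfNilpotent.minpoly_eq_charpoly_of_isNilpotent_of_rank hN
      (by rw [Fintype.card_fin]; exact hr)
    rw [hmin, Matrix.charpoly_natDegree_eq_dim, Fintype.card_fin]
  · intro h
    have hmin : minpoly 𝕜 N = N.charpoly :=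
      (Literature.LinearAlgebra.Matrix.natDegree_minpoly_eq_iff_minpoly_eq_charpoly N).1 (by rw [Fintype.card_fin]; exact h)
    -- `N` and `J_n(0)` are nonderogatory with the same characteristic polynomial, hence similar
    obtain ⟨S, hS, hNS⟩ := Literature.LinearAlgebra.Matrix.exists_conj_eq_of_minpoly_eq_charpoly
      (Literature.LinearAlgebra.Matrix.jordanBlock n (0 : 𝕜)) N
      (Literature.LinearAlgebra.Matrix.AdjugateOfNilpotent.minpoly_jordanBlock_zero_eq_charpoly n) hmin
      (by rw [Literature.LinearAlgebra.Matrix.charpoly_jordanBlock, map_zero, sub_zero, hchar])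
    rw [hNS, Matrix.rank_mul_eq_left_of_isUnit_det S _ hS,
      Matrix.rank_mul_eq_right_of_isUnit_det S⁻¹ _ ((Matrix.isUnit_nonsing_inv_det_iff (A := S)).2 hS),
      Literature.LinearAlgebra.Matrix.AdjugateOfNilpotent.rank_jordanBlock_zero]

/-- `deg q_{M + c} ≤ deg q_M` for a scalar `c`. [cite: HornJohnson2013, Thm 3.3.1 p. 192] -/
theorem natDegree_minpoly_add_algebraMap_le (M : Matrix (Fin n) (Fin n) 𝕜) (c : 𝕜) :
    (minpoly 𝕜 (M + algebraMap 𝕜 (Matrix (Fin n) (Fin n) 𝕜) c)).natDegree ≤ (minpoly 𝕜 M).natDegree := by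
  -- `q_M(X − c)` is monic of degree `deg q_M` and kills `M + c`
  have hmon : ((minpoly 𝕜 M).comp (X - C c)).Monic := (minpoly.monic (Matrix.isIntegral M)).comp_X_sub_C c
  have hzero : Polynomial.aeval (M + algebraMap 𝕜 (Matrix (Fin n) (Fin n) 𝕜) c) ((minpoly 𝕜 M).comp (X - C c)) = 0 := by
    rw [Polynomial.aeval_comp, map_sub, Polynomial.aeval_X, Polynomial.aeval_C, add_sub_cancel_right, minpoly.aeval]
  have h := Polynomial.natDegree_le_natDegree (minpoly.min 𝕜 _ hmon hzero)
  rwa [Polynomial.natDegree_comp, Polynomial.natDegree_X_sub_C, mul_one] at h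

/-- `deg q_{M − 1} = deg q_M` (`q_{M−1}(X) = q_M(X + 1)`). [cite: HornJohnson2013, Thm 3.3.1 p. 192] -/
theorem natDegree_minpoly_sub_one (M : Matrix (Fin n) (Fin n) 𝕜) : (minpoly 𝕜 (M - 1)).natDegree = (minpoly 𝕜 M).natDegree := by
  refine le_antisymm ?_ ?_
  · have h := natDegree_minpoly_add_algebraMap_le M (-1)
    rwa [map_neg, map_one, ← sub_eq_add_neg] at h
  · have h := natDegree_minpoly_add_algebraMap_le (M - 1) 1
    rwa [map_one, sub_add_cancel] at h

/-- **UNIPOTENT `M`: `rank (M − 1) = n − 1 ↔ M` HAS A CYCLIC VECTOR** (`v, Mv, …, M^{n−1}v` a basis): one Jordan block ⟺ nonderogatory ⟺ cyclic.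
[cite: HornJohnson2013, §3.2 Problem 3.2.P27 (b) p. 250; Thm 3.3.15 (a) p. 257] [cite: Hungerford1974, Thm VII.4.3 pp. 467–468] -/
theorem rank_sub_one_eq_iff_exists_linearIndependent_pow_mulVec {M : Matrix (Fin n) (Fin n) 𝕜} (hM : IsNilpotent (M - 1)) :
    (M - 1).rank = n - 1 ↔ ∃ v : Fin n → 𝕜, LinearIndependent 𝕜 fun j : Fin n => M ^ (j : ℕ) *ᵥ v := by
  rw [rank_eq_sub_one_iff_natDegree_minpoly_eq_of_isNilpotent hM, natDegree_minpoly_sub_one,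
    exists_linearIndependent_pow_mulVec_iff_natDegree_minpoly_eq]

end Field

/-! ## §2 Over `𝒪`: a cyclic vector of the reduction lifts to an `𝒪`-basis `v, kv, …, k^{n−1}v` of `𝒪ⁿ` (Nakayama by the determinant) -/

section Integral

open Literature.NumberTheory.Automorphic.IntegralReduction

variable {F : Type*} [Field F] [ValuativeRel F] {n : ℕ}

/-- Powers of an integral matrix are integral. [cite: Matsumura1987, Thm 2.2 p. 8] -/
theorem valBound_one_pow {M : Matrix (Fin n) (Fin n) F} (hM : ValBound 1 M) (j : ℕ) : ValBound 1 (M ^ j) := by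
  induction j with
  | zero => rw [pow_zero]; exact valBound_one
  | succ j ih => rw [pow_succ, ← one_mul (1 : ValueGroupWithZero F)]; exact ih.mul hM

/-- `red (M^j) = (red M)^j` for an integral matrix. [cite: Matsumura1987, Thm 2.2 p. 8] -/
theorem redMat_pow {M : Matrix (Fin n) (Fin n) F} (hM : ValBound 1 M) (j : ℕ) : redMat (M ^ j) = redMat M ^ j := by
  induction j with
  | zero => rw [pow_zero, pow_zero, redMat_one]
  | succ j ih => rw [pow_succ, pow_succ, redMat_mul (valBound_one_pow hM j) hM, ih]

/-- `red ((M v)_i) = (M̄ v̄)_i` for integral `M`, `v`. [cite: Matsumura1987, Thm 2.2 p. 8] -/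
theorem red_mulVec_apply {M : Matrix (Fin n) (Fin n) F} (hM : ValBound 1 M) {v : Fin n → F} (hv : ∀ i, v i ∈ 𝒪[F]) (i : Fin n) :
    red ((M *ᵥ v) i) = (redMat M *ᵥ fun l => red (v l)) i := by
  obtain ⟨M₀, rfl⟩ := exists_mapMatrix_eq_of_valBound_one hM
  set v₀ : Fin n → 𝒪[F] := fun l => ⟨v l, hv l⟩ with hv₀
  have hv' : v = (𝒪[F]).subtype ∘ v₀ := by funext l; rfl
  have h1 : ((𝒪[F]).subtype.mapMatrix M₀ *ᵥ v) i = ((M₀ *ᵥ v₀) i : F) := by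
    rw [hv', RingHom.mapMatrix_apply, ← RingHom.map_mulVec]; rfl
  have h2 : (fun l => red (v l)) = IsLocalRing.residue 𝒪[F] ∘ v₀ := by
    funext l; rw [Function.comp_apply, hv₀, ← red_coe]
  rw [h1, red_coe, RingHom.map_mulVec, redMat_mapMatrix, h2, RingHom.mapMatrix_apply]

/-- An integral matrix applied to an integral vector gives an integral vector. [cite: Matsumura1987, Thm 2.2 p. 8] -/
theorem mulVec_apply_mem_integer {M : Matrix (Fin n) (Fin n) F} (hM : ValBound 1 M) {v : Fin n → F} (hv : ∀ i, v i ∈ 𝒪[F]) (i : Fin n) :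
    (M *ᵥ v) i ∈ 𝒪[F] := by
  rw [Matrix.mulVec, dotProduct]
  exact Subring.sum_mem _ fun l _ => Subring.mul_mem _ ((Valuation.mem_integer_iff _ _).2 (hM i l)) (hv l)

/-- The Krylov matrix `[v | kv | ⋯ | k^{n−1}v]` of an integral pair is integral. [cite: Matsumura1987, Thm 2.2 p. 8] -/
theorem isIntegralMatrix_krylov {k : Matrix (Fin n) (Fin n) F} (hk : ValBound 1 k) {v : Fin n → F} (hv : ∀ i, v i ∈ 𝒪[F]) :
    IsIntegralMatrix (Matrix.of fun i j : Fin n => (k ^ (j : ℕ) *ᵥ v) i) := fun i j => by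
  rw [Matrix.of_apply]
  exact mulVec_apply_mem_integer (valBound_one_pow hk j) hv i

/-- **Reduction of the Krylov matrix**: `red [v | kv | ⋯] = [v̄ | k̄v̄ | ⋯]`. [cite: Matsumura1987, Thm 2.2 p. 8] -/
theorem redMat_krylov {k : Matrix (Fin n) (Fin n) F} (hk : ValBound 1 k) {v : Fin n → F} (hv : ∀ i, v i ∈ 𝒪[F]) :
    redMat (Matrix.of fun i j : Fin n => (k ^ (j : ℕ) *ᵥ v) i) = Matrix.of fun i j : Fin n => (redMat k ^ (j : ℕ) *ᵥ fun l => red (v l)) i := by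
  ext i j
  rw [redMat, Matrix.map_apply, Matrix.of_apply, Matrix.of_apply, red_mulVec_apply (valBound_one_pow hk j) hv, redMat_pow hk]

omit [ValuativeRel F] in
/-- The columns of the Krylov matrix are the `k^j v`. [cite: Hungerford1974, Thm VII.4.3 pp. 467–468] -/
theorem transpose_krylov_apply (k : Matrix (Fin n) (Fin n) F) (v : Fin n → F) (j : Fin n) :
    (Matrix.of fun i j : Fin n => (k ^ (j : ℕ) *ᵥ v) i)ᵀ j = k ^ (j : ℕ) *ᵥ v := by
  funext i
  rw [Matrix.transpose_apply, Matrix.of_apply]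

/-- **THE NAKAYAMA LIFT (by the determinant).**  For an INTEGRAL `k ∈ M_n(F)`: the reduction `k̄ ∈ M_n(𝓀)` has a cyclic vector iff
`𝒪ⁿ = ⊕_{i<n} 𝒪·k^i v` for some `v ∈ Fⁿ` (then `v ∈ 𝒪ⁿ`), i.e. `𝒪ⁿ` is free of rank one over `𝒪[k]` on `v`: a lift `v` of a cyclic `v̄` has Krylov matrix
`P` with `det P̄ ≠ 0`, so `P ∈ GL_n(𝒪)` and `Λ(P) = Λ(1) = 𝒪ⁿ`; conversely `Λ(P) = 𝒪ⁿ` forces `P ∈ GL_n(𝒪)`, `det P̄ ≠ 0`.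
[cite: Matsumura1987, Thm 2.3 p. 8] [cite: Hungerford1974, Thm VII.4.3 pp. 467–468] -/
theorem exists_linearIndependent_pow_redMat_mulVec_iff_exists_span_eq_one {k : Matrix (Fin n) (Fin n) F} (hk : ValBound 1 k) :
    (∃ vb : Fin n → 𝓀[F], LinearIndependent 𝓀[F] fun j : Fin n => redMat k ^ (j : ℕ) *ᵥ vb) ↔
      ∃ v : Fin n → F, Submodule.span 𝒪[F] (Set.range fun j : Fin n => k ^ (j : ℕ) *ᵥ v) =
        Submodule.span 𝒪[F] (Set.range (1 : Matrix (Fin n) (Fin n) F)ᵀ) := by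
  -- the Krylov matrix `P(v) = [v | kv | ⋯ | k^{n−1}v]` has columns spanning `span 𝒪 {k^j v}`
  have hcols : ∀ v : Fin n → F, Set.range (Matrix.of fun i j : Fin n => (k ^ (j : ℕ) *ᵥ v) i)ᵀ = Set.range fun j : Fin n => k ^ (j : ℕ) *ᵥ v := by
    intro v
    exact congrArg Set.range (funext fun j => transpose_krylov_apply k v j)
  constructor
  · rintro ⟨vb, hvb⟩
    -- lift `v̄` to an integral `v`
    obtain ⟨v₀, hv₀⟩ : ∃ v₀ : Fin n → 𝒪[F], ∀ l, IsLocalRing.residue 𝒪[F] (v₀ l) = vb l :=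
      ⟨fun l => Classical.choose (IsLocalRing.residue_surjective (vb l)), fun l => Classical.choose_spec (IsLocalRing.residue_surjective (vb l))⟩
    set v : Fin n → F := fun l => (v₀ l : F) with hvdef
    have hv : ∀ l, v l ∈ 𝒪[F] := fun l => (v₀ l).2
    have hred : (fun l => red (v l)) = vb := by
      funext l; rw [hvdef]; dsimp only; rw [red_coe, hv₀]
    refine ⟨v, ?_⟩
    -- `det P̄ ≠ 0`, so `|det P| = 1` and `P ∈ GL_n(𝒪)`
    set P : Matrix (Fin n) (Fin n) F := Matrix.of fun i j : Fin n => (k ^ (j : ℕ) *ᵥ v) i with hP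
    have hPint : IsIntegralMatrix P := isIntegralMatrix_krylov hk hv
    have hPval : ValBound 1 P := fun i j => (Valuation.mem_integer_iff _ _).1 (hPint i j)
    have hredP : redMat P = Matrix.of fun i j : Fin n => (redMat k ^ (j : ℕ) *ᵥ vb) i := by rw [hP, redMat_krylov hk hv, hred]
    have hLI : LinearIndependent 𝓀[F] (redMat P).col := by
      have hfun : (redMat P).col = fun j : Fin n => redMat k ^ (j : ℕ) *ᵥ vb := by
        funext j i
        rw [Matrix.col, hredP, Matrix.transpose_apply, Matrix.of_apply]
      rw [hfun]; exact hvb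
    have hdetred : (redMat P).det ≠ 0 :=
      ((Matrix.isUnit_iff_isUnit_det _).1 (Matrix.linearIndependent_cols_iff_isUnit.1 hLI)).ne_zero
    have hdet : valuation F P.det = 1 := by
      refine valuation_eq_one_of_red_ne_zero hPint.det_mem ?_
      rwa [red_det hPval]
    have hdet0 : P.det ≠ 0 := fun h => by rw [h, map_zero] at hdet; exact zero_ne_one hdet
    have hPunit : IsUnit P := (Matrix.isUnit_iff_isUnit_det P).2 (isUnit_iff_ne_zero.2 hdet0)
    have hmem : hPunit.unit ∈ glInt n F :=
      mem_glInt_of_isIntegralMatrix (by rw [hPunit.unit_spec]; exact hPint) (by rw [hPunit.unit_spec]; exact hdet)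
    have hΛ := (span_range_transpose_eq_one_iff_mem_glInt hPunit.unit).2 hmem
    rw [hPunit.unit_spec, hP, hcols] at hΛ
    exact hΛ
  · rintro ⟨v, hspan⟩
    set P : Matrix (Fin n) (Fin n) F := Matrix.of fun i j : Fin n => (k ^ (j : ℕ) *ᵥ v) i with hP
    -- `v = k^0 v ∈ 𝒪ⁿ`
    have hv : ∀ l, v l ∈ 𝒪[F] := by
      intro l
      have hmem : v ∈ Submodule.span 𝒪[F] (Set.range (1 : Matrix (Fin n) (Fin n) F)ᵀ) := by
        rw [← hspan]
        refine Submodule.subset_span ⟨⟨0, Fin.pos l⟩, ?_⟩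
        dsimp only; rw [pow_zero, Matrix.one_mulVec]
      exact (mem_span_range_transpose_one_iff v).1 hmem l
    have hPint : IsIntegralMatrix P := isIntegralMatrix_krylov hk hv
    have hPval : ValBound 1 P := fun i j => (Valuation.mem_integer_iff _ _).1 (hPint i j)
    -- the columns of `P` span `Fⁿ`, so `P` is invertible
    have htop : ⊤ ≤ Submodule.span F (Set.range fun j : Fin n => k ^ (j : ℕ) *ᵥ v) := by
      have h1 : Submodule.span F (Set.range fun j : Fin n => k ^ (j : ℕ) *ᵥ v) =
          Submodule.span F (Set.range (1 : Matrix (Fin n) (Fin n) F)ᵀ) := by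
        rw [← Submodule.span_span_of_tower 𝒪[F] F (Set.range fun j : Fin n => k ^ (j : ℕ) *ᵥ v), hspan, Submodule.span_span_of_tower]
      have h2 : Set.range (1 : Matrix (Fin n) (Fin n) F)ᵀ = Set.range (Pi.basisFun F (Fin n)) := by
        rw [Matrix.transpose_one]
        congr 1
        funext i j
        rw [Pi.basisFun_apply, Matrix.one_eq_pi_single]
      rw [h1, h2, (Pi.basisFun F (Fin n)).span_eq]
    have hLI : LinearIndependent F fun j : Fin n => k ^ (j : ℕ) *ᵥ v :=
      linearIndependent_of_top_le_span_of_card_eq_finrank htop (by rw [Fintype.card_fin, Module.finrank_fin_fun])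
    have hPunit : IsUnit P := by
      rw [← Matrix.isUnit_transpose, ← Matrix.linearIndependent_rows_iff_isUnit]
      have hfun : Pᵀ.row = fun j : Fin n => k ^ (j : ℕ) *ᵥ v := by
        funext j; rw [Matrix.row, hP, transpose_krylov_apply]
      rw [hfun]; exact hLI
    -- `Λ(P) = Λ(1)`, so `P ∈ GL_n(𝒪)`, `|det P| = 1`, `det P̄ ≠ 0`
    have hmem : hPunit.unit ∈ glInt n F := by
      rw [← span_range_transpose_eq_one_iff_mem_glInt hPunit.unit, hPunit.unit_spec, hP, hcols, hspan]
    have hdet : valuation F P.det = 1 := by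
      have h := valuation_det_eq_one_of_mem_glInt hmem
      rwa [hPunit.unit_spec] at h
    have hdetred : (redMat P).det ≠ 0 := by
      rw [← red_det hPval]; exact red_ne_zero_of_valuation_eq_one hdet
    have hPredunit : IsUnit (redMat P) := (Matrix.isUnit_iff_isUnit_det _).2 (isUnit_iff_ne_zero.2 hdetred)
    refine ⟨fun l => red (v l), ?_⟩
    have hLI' := Matrix.linearIndependent_cols_iff_isUnit.2 hPredunit
    have hfun : (redMat P).col = fun j : Fin n => redMat k ^ (j : ℕ) *ᵥ fun l => red (v l) := by
      funext j i
      rw [Matrix.col, hP, redMat_krylov hk hv, Matrix.transpose_apply, Matrix.of_apply]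
    rwa [hfun] at hLI'

end Integral

/-! ## §3 Transport to a fixed coset `gK`, `k = g⁻¹γg ∈ GL_n(𝒪)`: THE HEAD -/

section Transport

open Literature.NumberTheory.Automorphic.IntegralReduction

variable {F : Type*} [Field F] [ValuativeRel F] {n : ℕ}

omit [ValuativeRel F] in
/-- `γ^j (g v) = g ((g⁻¹γg)^j v)`. [cite: Kottwitz1986, §3] -/
theorem mulVec_pow_conj_eq (γ g : GL (Fin n) F) (v : Fin n → F) (j : ℕ) :
    ((γ : Matrix (Fin n) (Fin n) F) ^ j) *ᵥ ((g : Matrix (Fin n) (Fin n) F) *ᵥ v) =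
      (g : Matrix (Fin n) (Fin n) F) *ᵥ ((((g⁻¹ * γ * g : GL (Fin n) F) : Matrix (Fin n) (Fin n) F) ^ j) *ᵥ v) := by
  rw [Matrix.mulVec_mulVec, Matrix.mulVec_mulVec, ← Units.val_pow_eq_pow_val, ← Units.val_pow_eq_pow_val, ← Units.val_mul, ← Units.val_mul]
  congr 2
  rw [show g⁻¹ * γ * g = g⁻¹ * γ * g⁻¹⁻¹ by rw [inv_inv], conj_pow, inv_inv, ← mul_assoc, ← mul_assoc, mul_inv_cancel, one_mul]

/-- `span 𝒪 {γ^j (g v)} = g · span 𝒪 {(g⁻¹γg)^j v}`. [cite: Kottwitz1986, §3] -/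
theorem span_range_pow_mulVec_eq_map (γ g : GL (Fin n) F) (v : Fin n → F) :
    Submodule.span 𝒪[F] (Set.range fun j : Fin n => ((γ : Matrix (Fin n) (Fin n) F) ^ (j : ℕ)) *ᵥ ((g : Matrix (Fin n) (Fin n) F) *ᵥ v)) =
      (Submodule.span 𝒪[F] (Set.range fun j : Fin n => ((((g⁻¹ * γ * g : GL (Fin n) F) : Matrix (Fin n) (Fin n) F) ^ (j : ℕ)) *ᵥ v))).map
        ((Matrix.toLin' (g : Matrix (Fin n) (Fin n) F)).restrictScalars 𝒪[F]) := by
  have hfun : (fun j : Fin n => ((γ : Matrix (Fin n) (Fin n) F) ^ (j : ℕ)) *ᵥ ((g : Matrix (Fin n) (Fin n) F) *ᵥ v)) =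
      ((Matrix.toLin' (g : Matrix (Fin n) (Fin n) F)).restrictScalars 𝒪[F]) ∘
        fun j : Fin n => ((((g⁻¹ * γ * g : GL (Fin n) F) : Matrix (Fin n) (Fin n) F) ^ (j : ℕ)) *ᵥ v) := by
    funext j
    rw [Function.comp_apply, LinearMap.coe_restrictScalars, Matrix.toLin'_apply, mulVec_pow_conj_eq]
  rw [hfun, Set.range_comp, Submodule.span_image]

/-- **TRANSPORT**: `Λ(g) = ⊕_{j<n} 𝒪·γ^j w` for some `w` iff `𝒪ⁿ = ⊕_{j<n} 𝒪·(g⁻¹γg)^j v` for some `v` (`w = g v`). [cite: Kottwitz1986, §3] -/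
theorem exists_span_eq_span_range_pow_mulVec_iff (γ g : GL (Fin n) F) :
    (∃ w : Fin n → F, Submodule.span 𝒪[F] (Set.range ((g : Matrix (Fin n) (Fin n) F))ᵀ) =
        Submodule.span 𝒪[F] (Set.range fun j : Fin n => ((γ : Matrix (Fin n) (Fin n) F) ^ (j : ℕ)) *ᵥ w)) ↔
      ∃ v : Fin n → F, Submodule.span 𝒪[F] (Set.range fun j : Fin n => ((((g⁻¹ * γ * g : GL (Fin n) F) : Matrix (Fin n) (Fin n) F) ^ (j : ℕ)) *ᵥ v)) =
        Submodule.span 𝒪[F] (Set.range (1 : Matrix (Fin n) (Fin n) F)ᵀ) := by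
  -- `Λ(g) = g · Λ(1)`
  have hΛg : Submodule.span 𝒪[F] (Set.range ((g : Matrix (Fin n) (Fin n) F))ᵀ) =
      (Submodule.span 𝒪[F] (Set.range (1 : Matrix (Fin n) (Fin n) F)ᵀ)).map ((Matrix.toLin' (g : Matrix (Fin n) (Fin n) F)).restrictScalars 𝒪[F]) := by
    rw [← span_range_transpose_mul, Matrix.mul_one]
  constructor
  · rintro ⟨w, hw⟩
    refine ⟨((g⁻¹ : GL (Fin n) F) : Matrix (Fin n) (Fin n) F) *ᵥ w, ?_⟩
    have hgw : (g : Matrix (Fin n) (Fin n) F) *ᵥ (((g⁻¹ : GL (Fin n) F) : Matrix (Fin n) (Fin n) F) *ᵥ w) = w := by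
      rw [Matrix.mulVec_mulVec, ← Units.val_mul, mul_inv_cancel, Units.val_one, Matrix.one_mulVec]
    apply map_toLin'_injective g
    rw [← span_range_pow_mulVec_eq_map, hgw, ← hw, hΛg]
  · rintro ⟨v, hv⟩
    exact ⟨(g : Matrix (Fin n) (Fin n) F) *ᵥ v, by rw [span_range_pow_mulVec_eq_map, hv, hΛg]⟩

/-- **THE HEAD — JORDAN RANK `n − 1` ⟺ FREE OF RANK ONE OVER `𝒪[γ]`.**  For `γ, g ∈ GL_n(F)` with `g⁻¹γg ∈ GL_n(𝒪)` (the coset `gK` is `γ`-fixed, the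
lattice `Λ(g) = g·𝒪ⁿ` is `γ`-stable) and RESIDUALLY UNIPOTENT (`red(g⁻¹γg) − 1` nilpotent): `rank (red(g⁻¹γg) − 1) = n − 1` iff
`Λ(g) = ⊕_{j<n} 𝒪·γ^j w` for some `w` — at `n = 3`: the reduction of `γ` on the fixed vertex `Λ(g)` is REGULAR unipotent iff `Λ(g)` is a free `𝒪[γ]`-module of
rank one (T3′ holder F0P3b-p01 (g11)'s stratum `n₂`). [cite: HornJohnson2013, §3.2 Problem 3.2.P27 (b) p. 250; Thm 3.3.15 (a) p. 257]
[cite: Matsumura1987, Thm 2.3 p. 8] [cite: Kottwitz1986, §3] [cite: Rogawski1990, §4.9 p. 54] -/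
theorem rank_redMat_sub_one_eq_iff_exists_span_eq_span_range_pow_mulVec (γ g : GL (Fin n) F) (hk : g⁻¹ * γ * g ∈ glInt n F)
    (hu : IsNilpotent (redMat ((g⁻¹ * γ * g : GL (Fin n) F) : Matrix (Fin n) (Fin n) F) - 1)) :
    (redMat ((g⁻¹ * γ * g : GL (Fin n) F) : Matrix (Fin n) (Fin n) F) - 1).rank = n - 1 ↔
      ∃ w : Fin n → F, Submodule.span 𝒪[F] (Set.range ((g : Matrix (Fin n) (Fin n) F))ᵀ) =
        Submodule.span 𝒪[F] (Set.range fun j : Fin n => ((γ : Matrix (Fin n) (Fin n) F) ^ (j : ℕ)) *ᵥ w) := by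
  have hkv : ValBound 1 ((g⁻¹ * γ * g : GL (Fin n) F) : Matrix (Fin n) (Fin n) F) :=
    fun i j => (Valuation.mem_integer_iff _ _).1 (((mem_glInt_iff _).1 hk).1 i j)
  rw [rank_sub_one_eq_iff_exists_linearIndependent_pow_mulVec hu, exists_linearIndependent_pow_redMat_mulVec_iff_exists_span_eq_one hkv,
    exists_span_eq_span_range_pow_mulVec_iff]

end Transport

end Literature.NumberTheory.Automorphic

end
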